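import Literature.Probability.RandomPlanarGeometry.YangBaxterSAWGeneralDomain
import Literature.Probability.RandomPlanarGeometry.YangBaxterSAWYBE
import Mathlib.Algebra.Polynomial.Roots
import Mathlib.Analysis.SpecialFunctions.Complex.Log
import HarnessLib

/-!
# Barrier catalogue (SAWScalingLimit): the printed Yang–Baxter vertex functional is a trigonometric RATIONAL function of
the angle — at most `4K + 1` zero angles unless it vanishes identically

In the variable `Z = e^{3iθ/8}` every printed weight of [GlazmanManolescu2019, eq. (1)] times the common denominator
`weightDen θ = sin(5π/4 + 3θ/8)·sin(5π/8 − 3θ/8)`, times `Z²`, is a polynomial in `Z` of degree `≤ 4`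
(each sine `sin(α ± 3θ/8)` contributes `Z·sin = (e^{∓iα}·Z^{1∓1…})`, degree ≤ 2), and the contour coefficient is
`r(θ) = e^{5iπ/16}·Z`. Hence for every finite face list `Dl`, root `a` and plaquette `f₀` there is a polynomial `P`
with `natDegree P ≤ 4K + 1` such that `(Z² · weightDen θ)^K · VF_{Dl}(a, f₀; θ) = P(Z(θ))` for all `θ` with
`weightDen θ ≠ 0` — `K` the largest total weight exponent `n_{u₁}+n_{u₂}+n_v+n_{w₁}+n_{w₂}` of a walk counted in the
functional (`maxExp`; at most the number of plaquettes a walk visits). Since `θ ↦ Z(θ)` is injective on `(0, π)` and `weightDen ≠ 0` there: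

* ★ `vertexFunctional_printed_zero_count` — EITHER `VF(θ) = 0` for every `θ ∈ (0, π)`, OR the set of zero angles in
  `(0, π)` is finite with AT MOST `4K + 1` elements.

This sharpens the lane's «finite or everything» (`PlaquetteWalkAngleAnalyticity`, identity principle) to an explicit
count; elementary algebra, recorded because the venture lane's statements quantify over the angle.
-/

noncomputable section

namespace Literature.Barriers.CriticalPhenomena.PlaquetteWalk

open Literature.Probability.RandomPlanarGeometry.SAW.YangBaxter
open Real Complex Polynomial Set

/-! ## The variable `Z = e^{3iθ/8}` and the sines as polynomials in `Z` -/

section ZVar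

/-- `Z(θ) = e^{3iθ/8}`. [cite: GlazmanManolescu2019, §1, eq. (1)] -/
def Zθ (θ : ℝ) : ℂ := Complex.exp (((3 * θ / 8 : ℝ) : ℂ) * I)

/-- `Z(θ) ≠ 0`. [cite: GlazmanManolescu2019, §1, eq. (1)] -/
theorem Zθ_ne_zero (θ : ℝ) : Zθ θ ≠ 0 := Complex.exp_ne_zero _

/-- `θ ↦ Z(θ)` is injective on `(0, π)` (indeed on any interval of length `< 16π/3`). [folklore] -/
private theorem Zθ_injOn : Set.InjOn Zθ (Set.Ioo 0 π) := by
  intro θ hθ θ' hθ' h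
  obtain ⟨n, hn⟩ := Complex.exp_eq_exp_iff_exists_int.1 h
  have him := congrArg Complex.im hn
  simp only [Complex.mul_im, Complex.ofReal_re, Complex.ofReal_im, Complex.I_re, Complex.I_im, mul_zero, mul_one,
    add_zero, Complex.add_im, Complex.mul_re, Complex.intCast_re, Complex.intCast_im, zero_mul, sub_zero,
    Complex.re_ofNat, Complex.im_ofNat] at him
  -- him : 3 * θ / 8 = 3 * θ' / 8 + n * (2 * π)
  have hb : |(3 * θ / 8 - 3 * θ' / 8 : ℝ)| < 2 * π := by
    rw [abs_lt]; constructor <;> nlinarith [hθ.1, hθ.2, hθ'.1, hθ'.2, Real.pi_pos]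
  have hn0 : (n : ℝ) = 0 := by
    by_contra hne
    have h1 : (1 : ℝ) ≤ |(n : ℝ)| := by
      rw [← Int.cast_abs]; exact_mod_cast Int.one_le_abs (fun e => hne (by simp [e]))
    have h2 : 2 * π ≤ |(3 * θ / 8 - 3 * θ' / 8 : ℝ)| := by
      rw [show (3 * θ / 8 - 3 * θ' / 8 : ℝ) = n * (2 * π) by linarith, abs_mul, abs_of_pos Real.two_pi_pos]
      nlinarith [Real.pi_pos, h1]
    linarith
  have e : 3 * θ / 8 = 3 * θ' / 8 := by
    have := him; rw [hn0, zero_mul, add_zero] at this; exact this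
  linarith

/-- The polynomial of `sin(α + 3θ/8)`: `Z·sin(α + 3θ/8) = P⁺_α(Z)`, `P⁺_α = (e^{−iα}·i/2) − (e^{iα}·i/2)·X²`. [cite: GlazmanManolescu2019, §1, eq. (1) (the weights are quotients of products of sines of the angle)] -/
def sinPolyP (α : ℝ) : ℂ[X] :=
  C (Complex.exp (-((α : ℂ) * I)) * I / 2) - C (Complex.exp ((α : ℂ) * I) * I / 2) * X ^ 2

/-- The polynomial of `sin(β − 3θ/8)`: `Z·sin(β − 3θ/8) = P⁻_β(Z)`, `P⁻_β = (e^{−iβ}·i/2)·X² − (e^{iβ}·i/2)`. [cite: GlazmanManolescu2019, §1, eq. (1) (the weights are quotients of products of sines of the angle)] -/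
def sinPolyM (β : ℝ) : ℂ[X] :=
  C (Complex.exp (-((β : ℂ) * I)) * I / 2) * X ^ 2 - C (Complex.exp ((β : ℂ) * I) * I / 2)

/-- `natDegree P⁺_α ≤ 2`. [folklore] -/
private theorem natDegree_sinPolyP_le (α : ℝ) : (sinPolyP α).natDegree ≤ 2 := by
  unfold sinPolyP
  refine (natDegree_sub_le _ _).trans (max_le (by simp) ?_)
  exact natDegree_C_mul_X_pow_le _ _

/-- `natDegree P⁻_β ≤ 2`. [folklore] -/
private theorem natDegree_sinPolyM_le (β : ℝ) : (sinPolyM β).natDegree ≤ 2 := by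
  unfold sinPolyM
  refine (natDegree_sub_le _ _).trans (max_le ?_ (by simp))
  exact natDegree_C_mul_X_pow_le _ _

/-- `Z·sin(α + 3θ/8) = P⁺_α(Z)`. [cite: GlazmanManolescu2019, §1, eq. (1)] -/
theorem Zθ_mul_sin_add (α θ : ℝ) :
    Zθ θ * ((Real.sin (α + 3 * θ / 8) : ℝ) : ℂ) = (sinPolyP α).eval (Zθ θ) := by
  simp only [sinPolyP, eval_sub, eval_mul, eval_C, eval_pow, eval_X, Complex.ofReal_sin, Complex.sin, Zθ]
  have e1 : Complex.exp (-(((α + 3 * θ / 8 : ℝ) : ℂ)) * I) = Complex.exp (-((α : ℂ) * I)) * (Complex.exp (((3 * θ / 8 : ℝ) : ℂ) * I))⁻¹ := by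
    rw [← Complex.exp_neg, ← Complex.exp_add]; congr 1; push_cast; ring
  have e2 : Complex.exp ((((α + 3 * θ / 8 : ℝ) : ℂ)) * I) = Complex.exp ((α : ℂ) * I) * Complex.exp (((3 * θ / 8 : ℝ) : ℂ) * I) := by
    rw [← Complex.exp_add]; congr 1; push_cast; ring
  rw [e1, e2]
  have hz : Complex.exp (((3 * θ / 8 : ℝ) : ℂ) * I) ≠ 0 := Complex.exp_ne_zero _
  field_simp

/-- `Z·sin(β − 3θ/8) = P⁻_β(Z)`. [cite: GlazmanManolescu2019, §1, eq. (1)] -/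
theorem Zθ_mul_sin_sub (β θ : ℝ) :
    Zθ θ * ((Real.sin (β - 3 * θ / 8) : ℝ) : ℂ) = (sinPolyM β).eval (Zθ θ) := by
  simp only [sinPolyM, eval_sub, eval_mul, eval_C, eval_pow, eval_X, Complex.ofReal_sin, Complex.sin, Zθ]
  have e1 : Complex.exp (-(((β - 3 * θ / 8 : ℝ) : ℂ)) * I) = Complex.exp (-((β : ℂ) * I)) * Complex.exp (((3 * θ / 8 : ℝ) : ℂ) * I) := by
    rw [← Complex.exp_add]; congr 1; push_cast; ring
  have e2 : Complex.exp ((((β - 3 * θ / 8 : ℝ) : ℂ)) * I) = Complex.exp ((β : ℂ) * I) * (Complex.exp (((3 * θ / 8 : ℝ) : ℂ) * I))⁻¹ := by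
    rw [← Complex.exp_neg, ← Complex.exp_add]; congr 1; push_cast; ring
  rw [e1, e2]
  have hz : Complex.exp (((3 * θ / 8 : ℝ) : ℂ) * I) ≠ 0 := Complex.exp_ne_zero _
  field_simp

end ZVar

/-! ## The printed weights times the denominator as polynomials in `Z` -/

section WeightPolys

/-- `Z²·weightDen` as a polynomial in `Z` (degree ≤ 4). [cite: GlazmanManolescu2019, §1, eq. (1)] -/
def ybDenPoly : ℂ[X] := sinPolyP (5 * π / 4) * sinPolyM (5 * π / 8)

/-- `Z²·u₁·weightDen` as a polynomial in `Z`. [cite: GlazmanManolescu2019, §1, eq. (1)] -/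
def ybU1Poly : ℂ[X] := C ((Real.sin (5 * π / 4) : ℝ) : ℂ) * X * sinPolyP (5 * π / 8)

/-- `Z²·u₂·weightDen` as a polynomial in `Z`. [cite: GlazmanManolescu2019, §1, eq. (1)] -/
def ybU2Poly : ℂ[X] := C ((Real.sin (5 * π / 4) : ℝ) : ℂ) * X * sinPolyP 0

/-- `Z²·v·weightDen` as a polynomial in `Z`. [cite: GlazmanManolescu2019, §1, eq. (1)] -/
def ybVPoly : ℂ[X] := sinPolyP (5 * π / 8) * sinPolyM 0

/-- `Z²·w₁·weightDen` as a polynomial in `Z`. [cite: GlazmanManolescu2019, §1, eq. (1)] -/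
def ybW1Poly : ℂ[X] := sinPolyP (5 * π / 8) * sinPolyM (5 * π / 4)

/-- `Z²·w₂·weightDen` as a polynomial in `Z`. [cite: GlazmanManolescu2019, §1, eq. (1)] -/
def ybW2Poly : ℂ[X] := sinPolyP (15 * π / 8) * sinPolyM 0

/-- Degree bookkeeping: a product of two sine polynomials has degree `≤ 4`. [folklore] -/
private theorem natDegree_PM_le (α β : ℝ) : (sinPolyP α * sinPolyM β).natDegree ≤ 4 :=
  natDegree_mul_le.trans (by linarith [natDegree_sinPolyP_le α, natDegree_sinPolyM_le β])

/-- Degree bookkeeping: `const · X · P⁺` has degree `≤ 4`. [folklore] -/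
private theorem natDegree_CXP_le (c : ℂ) (α : ℝ) : (C c * X * sinPolyP α).natDegree ≤ 4 := by
  refine natDegree_mul_le.trans ?_
  have h1 : (C c * X : ℂ[X]).natDegree ≤ 1 := by
    simpa using natDegree_C_mul_X_pow_le c 1
  linarith [natDegree_sinPolyP_le α]

/-- `natDegree ybDenPoly ≤ 4`. [folklore] -/
private theorem natDegree_ybDenPoly_le : ybDenPoly.natDegree ≤ 4 := natDegree_PM_le _ _
/-- `natDegree ybU1Poly ≤ 4`. [folklore] -/
private theorem natDegree_ybU1Poly_le : ybU1Poly.natDegree ≤ 4 := natDegree_CXP_le _ _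
/-- `natDegree ybU2Poly ≤ 4`. [folklore] -/
private theorem natDegree_ybU2Poly_le : ybU2Poly.natDegree ≤ 4 := natDegree_CXP_le _ _
/-- `natDegree ybVPoly ≤ 4`. [folklore] -/
private theorem natDegree_ybVPoly_le : ybVPoly.natDegree ≤ 4 := natDegree_PM_le _ _
/-- `natDegree ybW1Poly ≤ 4`. [folklore] -/
private theorem natDegree_ybW1Poly_le : ybW1Poly.natDegree ≤ 4 := natDegree_PM_le _ _
/-- `natDegree ybW2Poly ≤ 4`. [folklore] -/
private theorem natDegree_ybW2Poly_le : ybW2Poly.natDegree ≤ 4 := natDegree_PM_le _ _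

/-- `Z²·weightDen θ = ybDenPoly(Z)`. [cite: GlazmanManolescu2019, §1, eq. (1)] -/
theorem den_eq_eval (θ : ℝ) : Zθ θ ^ 2 * ((weightDen θ : ℝ) : ℂ) = ybDenPoly.eval (Zθ θ) := by
  rw [weightDen, ybDenPoly, eval_mul, ← Zθ_mul_sin_add, ← Zθ_mul_sin_sub]; push_cast; ring

/-- `Z²·weightDen·u₁ = ybU1Poly(Z)` (denominator non-zero). [cite: GlazmanManolescu2019, §1, eq. (1)] -/
theorem u1_eq_eval {θ : ℝ} (h : weightDen θ ≠ 0) :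
    Zθ θ ^ 2 * ((weightDen θ : ℝ) : ℂ) * ((weightU1 θ : ℝ) : ℂ) = ybU1Poly.eval (Zθ θ) := by
  have e : weightDen θ * weightU1 θ = Real.sin (5 * π / 4) * Real.sin (5 * π / 8 + 3 * θ / 8) := by
    rw [weightU1, mul_div_cancel₀ _ h]
  rw [mul_assoc, ← Complex.ofReal_mul, e, ybU1Poly, eval_mul, eval_mul, eval_C, eval_X, ← Zθ_mul_sin_add]
  push_cast; ring

/-- `Z²·weightDen·u₂ = ybU2Poly(Z)`. [cite: GlazmanManolescu2019, §1, eq. (1)] -/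
theorem u2_eq_eval {θ : ℝ} (h : weightDen θ ≠ 0) :
    Zθ θ ^ 2 * ((weightDen θ : ℝ) : ℂ) * ((weightU2 θ : ℝ) : ℂ) = ybU2Poly.eval (Zθ θ) := by
  have e : weightDen θ * weightU2 θ = Real.sin (5 * π / 4) * Real.sin (0 + 3 * θ / 8) := by
    rw [weightU2, mul_div_cancel₀ _ h, zero_add]
  rw [mul_assoc, ← Complex.ofReal_mul, e, ybU2Poly, eval_mul, eval_mul, eval_C, eval_X, ← Zθ_mul_sin_add]
  push_cast; ring

/-- `Z²·weightDen·v = ybVPoly(Z)`. [cite: GlazmanManolescu2019, §1, eq. (1)] -/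
theorem v_eq_eval {θ : ℝ} (h : weightDen θ ≠ 0) :
    Zθ θ ^ 2 * ((weightDen θ : ℝ) : ℂ) * ((weightV θ : ℝ) : ℂ) = ybVPoly.eval (Zθ θ) := by
  have e : weightDen θ * weightV θ = Real.sin (5 * π / 8 + 3 * θ / 8) * Real.sin (0 - 3 * θ / 8) := by
    rw [weightV, mul_div_cancel₀ _ h, zero_sub]
  rw [mul_assoc, ← Complex.ofReal_mul, e, ybVPoly, eval_mul, ← Zθ_mul_sin_add, ← Zθ_mul_sin_sub]
  push_cast; ring

/-- `Z²·weightDen·w₁ = ybW1Poly(Z)`. [cite: GlazmanManolescu2019, §1, eq. (1)] -/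
theorem w1_eq_eval {θ : ℝ} (h : weightDen θ ≠ 0) :
    Zθ θ ^ 2 * ((weightDen θ : ℝ) : ℂ) * ((weightW1 θ : ℝ) : ℂ) = ybW1Poly.eval (Zθ θ) := by
  have e : weightDen θ * weightW1 θ = Real.sin (5 * π / 8 + 3 * θ / 8) * Real.sin (5 * π / 4 - 3 * θ / 8) := by
    rw [weightW1, mul_div_cancel₀ _ h]
  rw [mul_assoc, ← Complex.ofReal_mul, e, ybW1Poly, eval_mul, ← Zθ_mul_sin_add, ← Zθ_mul_sin_sub]
  push_cast; ring

/-- `Z²·weightDen·w₂ = ybW2Poly(Z)`. [cite: GlazmanManolescu2019, §1, eq. (1)] -/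
theorem w2_eq_eval {θ : ℝ} (h : weightDen θ ≠ 0) :
    Zθ θ ^ 2 * ((weightDen θ : ℝ) : ℂ) * ((weightW2 θ : ℝ) : ℂ) = ybW2Poly.eval (Zθ θ) := by
  have e : weightDen θ * weightW2 θ = Real.sin (15 * π / 8 + 3 * θ / 8) * Real.sin (0 - 3 * θ / 8) := by
    rw [weightW2, mul_div_cancel₀ _ h, zero_sub]
  rw [mul_assoc, ← Complex.ofReal_mul, e, ybW2Poly, eval_mul, ← Zθ_mul_sin_add, ← Zθ_mul_sin_sub]
  push_cast; ring

end WeightPolys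

/-! ## The weight monomial of a walk, the observable and the vertex functional as polynomials in `Z` -/

section Functional

/-- The total weight exponent `n_{u₁} + n_{u₂} + n_v + n_{w₁} + n_{w₂}` of a mid-edge list (number of visited plaquettes
carrying one of the five weighted configurations). [cite: GlazmanManolescu2019, §1, Fig. 1 and eq. (1)] -/
def totalExp (l : List MidEdge) : ℕ :=
  cfgCount l [.corner] + cfgCount l [.coCorner] + cfgCount l [.straight] +
    cfgCount l [.corner, .corner] + cfgCount l [.coCorner, .coCorner]

/-- The polynomial of a mid-edge list: `ybU1Poly^{n₁} · ybU2Poly^{n₂} · ybVPoly^{n_v} · ybW1Poly^{n_{w₁}} · ybW2Poly^{n_{w₂}}`.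
[cite: GlazmanManolescu2019, §1 ("the weight of a walk is the product of weights associated to each rhombus")] -/
def ybWalkPoly (l : List MidEdge) : ℂ[X] :=
  ybU1Poly ^ cfgCount l [.corner] * ybU2Poly ^ cfgCount l [.coCorner] * ybVPoly ^ cfgCount l [.straight] *
    ybW1Poly ^ cfgCount l [.corner, .corner] * ybW2Poly ^ cfgCount l [.coCorner, .coCorner]

/-- `natDegree (ybWalkPoly l) ≤ 4 · totalExp l`. [folklore] -/
private theorem natDegree_ybWalkPoly_le (l : List MidEdge) : (ybWalkPoly l).natDegree ≤ 4 * totalExp l := by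
  unfold ybWalkPoly totalExp
  have h1 := natDegree_pow_le (p := ybU1Poly) (n := cfgCount l [.corner])
  have h2 := natDegree_pow_le (p := ybU2Poly) (n := cfgCount l [.coCorner])
  have h3 := natDegree_pow_le (p := ybVPoly) (n := cfgCount l [.straight])
  have h4 := natDegree_pow_le (p := ybW1Poly) (n := cfgCount l [.corner, .corner])
  have h5 := natDegree_pow_le (p := ybW2Poly) (n := cfgCount l [.coCorner, .coCorner])
  have d1 := natDegree_ybU1Poly_le; have d2 := natDegree_ybU2Poly_le; have d3 := natDegree_ybVPoly_le
  have d4 := natDegree_ybW1Poly_le; have d5 := natDegree_ybW2Poly_le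
  have e1 : cfgCount l [.corner] * ybU1Poly.natDegree ≤ cfgCount l [.corner] * 4 := Nat.mul_le_mul_left _ d1
  have e2 : cfgCount l [.coCorner] * ybU2Poly.natDegree ≤ cfgCount l [.coCorner] * 4 := Nat.mul_le_mul_left _ d2
  have e3 : cfgCount l [.straight] * ybVPoly.natDegree ≤ cfgCount l [.straight] * 4 := Nat.mul_le_mul_left _ d3
  have e4 : cfgCount l [.corner, .corner] * ybW1Poly.natDegree ≤ cfgCount l [.corner, .corner] * 4 :=
    Nat.mul_le_mul_left _ d4
  have e5 : cfgCount l [.coCorner, .coCorner] * ybW2Poly.natDegree ≤ cfgCount l [.coCorner, .coCorner] * 4 :=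
    Nat.mul_le_mul_left _ d5
  refine natDegree_mul_le.trans ?_
  refine (Nat.add_le_add_right (natDegree_mul_le.trans (Nat.add_le_add_right (natDegree_mul_le.trans
    (Nat.add_le_add_right (natDegree_mul_le.trans (Nat.add_le_add h1 h2)) _)) _)) _).trans ?_
  omega

/-- **The weight monomial of a walk is a polynomial in `Z`**: `(Z²·weightDen)^{totalExp} · weightL = ybWalkPoly(Z)`.
[cite: GlazmanManolescu2019, §1, eq. (1)] -/
theorem weightL_printed_eq_eval (l : List MidEdge) {θ : ℝ} (h : weightDen θ ≠ 0) :
    (Zθ θ ^ 2 * ((weightDen θ : ℝ) : ℂ)) ^ totalExp l * weightL (printedWeights θ) l = (ybWalkPoly l).eval (Zθ θ) := by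
  simp only [weightL, CWeights.mono, printedWeights, totalExp, ybWalkPoly, eval_mul, eval_pow]
  rw [← u1_eq_eval h, ← u2_eq_eval h, ← v_eq_eval h, ← w1_eq_eval h, ← w2_eq_eval h]
  ring

/-- The largest total weight exponent of a walk from `a` to `z` (`0` if there is none).
[cite: GlazmanManolescu2019, §2.1, eq. (2.1)] -/
def maxExpTo (Dl : List Face) (a z : MidEdge) : ℕ :=
  Finset.univ.sup fun γ : YBWalk (dom Dl) a z => totalExp γ.mids

/-- The largest total weight exponent of a walk counted in the vertex functional at `f₀`.
[cite: GlazmanManolescu2019, Lemma 2.1] -/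
def maxExp (Dl : List Face) (a : MidEdge) (f₀ : Face) : ℕ :=
  Finset.univ.sup fun s : Fin 4 => maxExpTo Dl a (slotSide f₀ s)

/-- The polynomial of the observable at exponent budget `K`. [cite: GlazmanManolescu2019, §2.1, eq. (2.1)] -/
def ybObsPoly (Dl : List Face) (a z : MidEdge) (K : ℕ) : ℂ[X] :=
  ∑ γ : YBWalk (dom Dl) a z, C (tFiveEighths ^ quarterTurnsL γ.mids) * ybWalkPoly γ.mids * ybDenPoly ^ (K - totalExp γ.mids)

/-- `natDegree (ybObsPoly … K) ≤ 4K` when `K` bounds every walk's exponent. [folklore] -/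
private theorem natDegree_ybObsPoly_le (Dl : List Face) (a z : MidEdge) {K : ℕ} (hK : maxExpTo Dl a z ≤ K) :
    (ybObsPoly Dl a z K).natDegree ≤ 4 * K := by
  unfold ybObsPoly
  refine natDegree_sum_le_of_forall_le _ _ fun γ _ => ?_
  have hm : totalExp γ.mids ≤ K := (Finset.le_sup (f := fun γ : YBWalk (dom Dl) a z => totalExp γ.mids)
    (Finset.mem_univ γ)).trans hK
  have h1 := natDegree_ybWalkPoly_le γ.mids
  have h2 : (ybDenPoly ^ (K - totalExp γ.mids)).natDegree ≤ 4 * (K - totalExp γ.mids) := by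
    refine natDegree_pow_le.trans ?_
    have := Nat.mul_le_mul_left (K - totalExp γ.mids) natDegree_ybDenPoly_le
    linarith
  refine natDegree_mul_le.trans ?_
  have h3 := (natDegree_C_mul_le (tFiveEighths ^ quarterTurnsL γ.mids) (ybWalkPoly γ.mids)).trans h1
  have : 4 * totalExp γ.mids + 4 * (K - totalExp γ.mids) = 4 * K := by
    rw [← Nat.mul_add, Nat.add_sub_cancel' hm]
  linarith

/-- **The printed observable is a polynomial in `Z`**: `(Z²·weightDen)^K · F(z; θ) = ybObsPoly(Z)`.
[cite: GlazmanManolescu2019, §2.1, eq. (2.1) and eq. (1)] -/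
theorem gmObservable_printed_eq_eval (Dl : List Face) (a z : MidEdge) {K : ℕ} (hK : maxExpTo Dl a z ≤ K) {θ : ℝ}
    (h : weightDen θ ≠ 0) :
    (Zθ θ ^ 2 * ((weightDen θ : ℝ) : ℂ)) ^ K * gmObservable (printedWeights θ) tFiveEighths Dl a z =
      (ybObsPoly Dl a z K).eval (Zθ θ) := by
  simp only [gmObservable, ybObsPoly, eval_finsetSum, Finset.mul_sum, eval_mul, eval_C, eval_pow]
  refine Finset.sum_congr rfl fun γ _ => ?_
  have hm : totalExp γ.mids ≤ K := (Finset.le_sup (f := fun γ : YBWalk (dom Dl) a z => totalExp γ.mids)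
    (Finset.mem_univ γ)).trans hK
  rw [← weightL_printed_eq_eval γ.mids h, ← den_eq_eval θ]
  conv_lhs => rw [← Nat.add_sub_cancel' hm, pow_add]
  ring

/-- The polynomial of the slot coefficient `c_s(θ) ∈ {1, r(θ), −1, −r(θ)}`, `r(θ) = e^{5iπ/16}·Z`.
[cite: GlazmanManolescu2019, Lemma 2.1, eq. (CR)] -/
def ybCoeffPoly (s : Fin 4) : ℂ[X] :=
  ![C 1, C (Complex.exp (((5 * π / 16 : ℝ) : ℂ) * I)) * X, C (-1), C (-Complex.exp (((5 * π / 16 : ℝ) : ℂ) * I)) * X] s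

/-- `natDegree (ybCoeffPoly s) ≤ 1`. [folklore] -/
private theorem natDegree_ybCoeffPoly_le (s : Fin 4) : (ybCoeffPoly s).natDegree ≤ 1 := by
  fin_cases s <;> simp only [ybCoeffPoly, Fin.zero_eta, Fin.mk_one, Fin.reduceFinMk, Matrix.cons_val_zero,
    Matrix.cons_val_one, Matrix.cons_val]
  · simp
  · rw [← pow_one (X : ℂ[X])]; exact natDegree_C_mul_X_pow_le _ 1
  · simp
  · rw [← pow_one (X : ℂ[X])]; exact natDegree_C_mul_X_pow_le _ 1

/-- `r(θ) = e^{5iπ/16}·Z(θ)`. [cite: GlazmanManolescu2019, Lemma 2.1, eq. (CR)] -/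
theorem ybRatio_eq_mul_Zθ (θ : ℝ) : ybRatio θ = Complex.exp (((5 * π / 16 : ℝ) : ℂ) * I) * Zθ θ := by
  rw [ybRatio, Zθ, ← Complex.exp_add]; congr 1; push_cast; ring

/-- `c_s(θ) = ybCoeffPoly_s(Z)`. [cite: GlazmanManolescu2019, Lemma 2.1, eq. (CR)] -/
theorem ybCoeff_eq_eval (θ : ℝ) (s : Fin 4) : ybCoeff θ s = (ybCoeffPoly s).eval (Zθ θ) := by
  fin_cases s <;> simp [ybCoeff, ybCoeffPoly, ybRatio_eq_mul_Zθ]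

/-- **The polynomial of the vertex functional** at exponent budget `K`. [cite: GlazmanManolescu2019, Lemma 2.1] -/
def ybVFPoly (Dl : List Face) (a : MidEdge) (f₀ : Face) (K : ℕ) : ℂ[X] :=
  ∑ s : Fin 4, ybCoeffPoly s * ybObsPoly Dl a (slotSide f₀ s) K

/-- ★ `natDegree (ybVFPoly … K) ≤ 4K + 1` for `K ≥ maxExp`. [cite: GlazmanManolescu2019, Lemma 2.1] -/
private theorem natDegree_ybVFPoly_le (Dl : List Face) (a : MidEdge) (f₀ : Face) {K : ℕ} (hK : maxExp Dl a f₀ ≤ K) :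
    (ybVFPoly Dl a f₀ K).natDegree ≤ 4 * K + 1 := by
  unfold ybVFPoly
  refine natDegree_sum_le_of_forall_le _ _ fun s _ => ?_
  have hKs : maxExpTo Dl a (slotSide f₀ s) ≤ K :=
    (Finset.le_sup (f := fun s : Fin 4 => maxExpTo Dl a (slotSide f₀ s)) (Finset.mem_univ s)).trans hK
  refine natDegree_mul_le.trans ?_
  have := natDegree_ybCoeffPoly_le s; have := natDegree_ybObsPoly_le Dl a (slotSide f₀ s) hKs
  omega

/-- ★★ **The printed vertex functional is a polynomial in `Z = e^{3iθ/8}` after clearing denominators**: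
`(Z²·weightDen θ)^K · VF_{Dl}(a, f₀; θ) = ybVFPoly(Z(θ))` for every `θ` with `weightDen θ ≠ 0` and every `K ≥ maxExp`.
[cite: GlazmanManolescu2019, Lemma 2.1 and eq. (1)] -/
theorem vertexFunctional_printed_eq_eval (Dl : List Face) (a : MidEdge) (f₀ : Face) {K : ℕ}
    (hK : maxExp Dl a f₀ ≤ K) {θ : ℝ} (h : weightDen θ ≠ 0) :
    (Zθ θ ^ 2 * ((weightDen θ : ℝ) : ℂ)) ^ K * vertexFunctional (printedWeights θ) tFiveEighths (ybCoeff θ) Dl a f₀ =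
      (ybVFPoly Dl a f₀ K).eval (Zθ θ) := by
  simp only [vertexFunctional, ybVFPoly, eval_finsetSum, Finset.mul_sum, eval_mul]
  refine Finset.sum_congr rfl fun s _ => ?_
  have hKs : maxExpTo Dl a (slotSide f₀ s) ≤ K :=
    (Finset.le_sup (f := fun s : Fin 4 => maxExpTo Dl a (slotSide f₀ s)) (Finset.mem_univ s)).trans hK
  rw [← gmObservable_printed_eq_eval Dl a _ hKs h, ybCoeff_eq_eval]
  ring

end Functional

/-! ## Counting the zero angles -/

section ZeroCount

/-- ★★★ **AT MOST `4K + 1` ZERO ANGLES, OR IDENTICALLY ZERO.** For every finite face list, root and plaquette,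
with `K = maxExp Dl a f₀` the largest total weight exponent of a walk counted in the functional: EITHER the printed
vertex functional vanishes at every `θ ∈ (0, π)`, OR its zero angles in `(0, π)` are finitely many, at most `4K + 1`.
[cite: GlazmanManolescu2019, Lemma 2.1 and eq. (1)] -/
theorem vertexFunctional_printed_zero_count (Dl : List Face) (a : MidEdge) (f₀ : Face) :
    (∀ θ ∈ Set.Ioo 0 π, vertexFunctional (printedWeights θ) tFiveEighths (ybCoeff θ) Dl a f₀ = 0) ∨
      ({θ ∈ Set.Ioo 0 π | vertexFunctional (printedWeights θ) tFiveEighths (ybCoeff θ) Dl a f₀ = 0}.Finite ∧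
        {θ ∈ Set.Ioo 0 π | vertexFunctional (printedWeights θ) tFiveEighths (ybCoeff θ) Dl a f₀ = 0}.ncard ≤
          4 * maxExp Dl a f₀ + 1) := by
  set K := maxExp Dl a f₀ with hKdef
  set P := ybVFPoly Dl a f₀ K with hP
  have key : ∀ θ ∈ Set.Ioo 0 π, (Zθ θ ^ 2 * ((weightDen θ : ℝ) : ℂ)) ^ K *
      vertexFunctional (printedWeights θ) tFiveEighths (ybCoeff θ) Dl a f₀ = P.eval (Zθ θ) :=
    fun θ hθ => vertexFunctional_printed_eq_eval Dl a f₀ le_rfl (weightDen_ne_zero_of_mem_Ioo hθ)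
  have hA : ∀ θ ∈ Set.Ioo 0 π, (Zθ θ ^ 2 * ((weightDen θ : ℝ) : ℂ)) ^ K ≠ 0 := fun θ hθ =>
    pow_ne_zero _ (mul_ne_zero (pow_ne_zero _ (Zθ_ne_zero θ))
      (by exact_mod_cast weightDen_ne_zero_of_mem_Ioo hθ))
  by_cases hP0 : P = 0
  · left
    intro θ hθ
    have := key θ hθ
    rw [hP0, eval_zero] at this
    exact (mul_eq_zero.1 this).resolve_left (hA θ hθ)
  · right
    set S := {θ ∈ Set.Ioo 0 π | vertexFunctional (printedWeights θ) tFiveEighths (ybCoeff θ) Dl a f₀ = 0} with hS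
    have hmaps : ∀ θ ∈ S, Zθ θ ∈ (P.roots.toFinset : Set ℂ) := by
      intro θ hθ
      rw [Finset.mem_coe, Multiset.mem_toFinset, mem_roots hP0, IsRoot.def, ← key θ hθ.1, hθ.2, mul_zero]
    have hinj : Set.InjOn Zθ S := Zθ_injOn.mono fun θ hθ => hθ.1
    have hfin : S.Finite :=
      Set.Finite.of_finite_image ((Finset.finite_toSet _).subset (Set.image_subset_iff.2 hmaps)) hinj
    refine ⟨hfin, ?_⟩
    calc S.ncard ≤ (P.roots.toFinset : Set ℂ).ncard := Set.ncard_le_ncard_of_injOn Zθ hmaps hinj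
      _ = P.roots.toFinset.card := Set.ncard_coe_finset _
      _ ≤ Multiset.card P.roots := Multiset.toFinset_card_le _
      _ ≤ P.natDegree := card_roots' P
      _ ≤ 4 * K + 1 := natDegree_ybVFPoly_le Dl a f₀ le_rfl

end ZeroCount

end Literature.Barriers.CriticalPhenomena.PlaquetteWalk
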